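import Mathlib
import Summits.Ventures.PercRepro2.HCov
import Summits.Ventures.PercRepro2.RootLeafUTheorem
import Summits.Ventures.PercRepro2.RootLeafUSecond

/-!
# (G4-u): the sign of record `0 ≤ X5` reduced to ONE inequality with a single unsigned factor
(blind cell PercRepro2, p4 g5; proofs/P4-G5-STRUCTURE.md §1, the payment / deficit form)

With the atoms `ℋ, ℰ, 𝒟, 𝒞` of RootLeafUSecond (`Z·T2 = Gc(a₁ := u) + X5`, `X5 = Z·(d0·𝒟 + e0·ℰ) + ℋ·(Z·hb − gap)`,
`Gc(a₁ := u) = D·𝒟 + Do·ℰ`), eliminating the unsigned atom `𝒟` through the second Euler identity gives the CLEARED identity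

  `D · X5 = D·(Z·hb − gap)·ℋ + Z·d0·Gc(a₁ := u) − Z·(d0·Do − D·e0)·ℰ`      (`D_mul_X5_eq`),

in which `ℋ ≥ 0`, `ℰ ≥ 0`, `Z·hb − gap ≥ 0` are theorems (RootLeafUSecond) and `Gc(a₁ := u) ≥ 0` is the induction
hypothesis of the class: the ONLY unsigned factor left is the «deficit» `Kdef = d0·Do − D·e0 = D·d0·(γ¹ − θ₀)`,
`γ¹ = P(o ∈ U | PD)`, `θ₀ = P(o ∈ K | c ∉ K)`.  Hence (`X5_nonneg_of_key`, `T2_nonneg_of_key`): on `D > 0`, the sign of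
record follows from the KEY inequality `Z·Kdef·ℰ ≤ D·(Z·hb − gap)·ℋ + Z·d0·Gc(a₁ := u)` — and the class (G4-u) itself
from the weaker `Z·Kdef·ℰ ≤ D·(Z·hb − gap)·ℋ + (Z·d0 + D)·Gc(a₁ := u)`.  Census (p4 g5, 400 instances): the
`Gc`-free version of KEY fails on 1 / 400 (ratio 1.096), so the induction term is needed; KEY with the `Gc` term is
`X5 ≥ 0` itself (0 / 3,600 + 0 / 4,800 adversarial, kit j245219).
-/

namespace Summit.Ventures.PercRepro2

open UnionCluster CovForm

namespace RootLeafU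

variable {V : Type*} {E : Type*} [Fintype E] [DecidableEq E] [Fintype V] [DecidableEq V]
  {R : Type*} [Field R] [LinearOrder R] [IsStrictOrderedRing R]

section Key

variable (p : E → R) (ends : E → Sym2 V) (o a₂ c b u : V)

/-- **The deficit** `Kdef = d0·Do − D·e0` (`= D·d0·(γ¹ − θ₀)`): the only unsigned factor of the cleared `X5`. -/
noncomputable def Kdef : R :=
  prob p (avoidAll ends a₂ {c}) * Do p ends o u a₂ c -
    prob p (PDEvent ends u a₂ c) * prob p (avoidAll ends a₂ {c} ∩ connEvent ends a₂ o)

omit [Fintype V] [DecidableEq V] [LinearOrder R] [IsStrictOrderedRing R] in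
/-- **The cleared payment / deficit identity**:
`D·X5 = D·(Z·hb − gap)·ℋ + Z·d0·Gc(a₁ := u) − Z·Kdef·ℰ`. -/
theorem D_mul_X5_eq :
    prob p (PDEvent ends u a₂ c) * X5 p ends o a₂ c b u =
      prob p (PDEvent ends u a₂ c) *
          (prob p (avoidAll ends a₂ {u}) * prob p (connEvent ends a₂ b) - gap p ends u a₂ b) *
          Hh p ends o a₂ c u +
        prob p (avoidAll ends a₂ {u}) * prob p (avoidAll ends a₂ {c}) * Gc p ends o u a₂ c b -
        prob p (avoidAll ends a₂ {u}) * Kdef p ends o a₂ c u * Ee p ends a₂ c b u := by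
  rw [Gc_eq_Dd_Ee]
  unfold X5 Kdef
  ring

omit [Fintype V] [DecidableEq V] in
/-- **`0 ≤ X5` from the KEY inequality** (on `D > 0`):
`Z·Kdef·ℰ ≤ D·(Z·hb − gap)·ℋ + Z·d0·Gc(a₁ := u)`. -/
theorem X5_nonneg_of_key (hD : 0 < prob p (PDEvent ends u a₂ c))
    (hkey : prob p (avoidAll ends a₂ {u}) * Kdef p ends o a₂ c u * Ee p ends a₂ c b u ≤
      prob p (PDEvent ends u a₂ c) *
          (prob p (avoidAll ends a₂ {u}) * prob p (connEvent ends a₂ b) - gap p ends u a₂ b) *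
          Hh p ends o a₂ c u +
        prob p (avoidAll ends a₂ {u}) * prob p (avoidAll ends a₂ {c}) * Gc p ends o u a₂ c b) :
    0 ≤ X5 p ends o a₂ c b u := by
  have h := D_mul_X5_eq p ends o a₂ c b u
  have hprod : 0 ≤ prob p (PDEvent ends u a₂ c) * X5 p ends o a₂ c b u := by
    rw [h]; linarith
  exact (mul_nonneg_iff_of_pos_left hD).1 hprod

omit [Fintype V] [DecidableEq V] in
/-- **(G4-u) from the weaker KEY′** (on `D > 0`, with the induction hypothesis):
`Z·Kdef·ℰ ≤ D·(Z·hb − gap)·ℋ + (Z·d0 + D)·Gc(a₁ := u)` gives `0 ≤ T2`. -/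
theorem T2_nonneg_of_key' (hp : IsProbVec p) (hD : 0 < prob p (PDEvent ends u a₂ c))
    (hkey : prob p (avoidAll ends a₂ {u}) * Kdef p ends o a₂ c u * Ee p ends a₂ c b u ≤
      prob p (PDEvent ends u a₂ c) *
          (prob p (avoidAll ends a₂ {u}) * prob p (connEvent ends a₂ b) - gap p ends u a₂ b) *
          Hh p ends o a₂ c u +
        (prob p (avoidAll ends a₂ {u}) * prob p (avoidAll ends a₂ {c}) +
          prob p (PDEvent ends u a₂ c)) * Gc p ends o u a₂ c b) :
    0 ≤ T2 p ends o a₂ c b u := by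
  have h := D_mul_X5_eq p ends o a₂ c b u
  have hZ := Z_mul_T2_eq p ends o a₂ c b u
  rcases (prob_nonneg hp (avoidAll ends a₂ {u})).lt_or_eq with hZpos | hZzero
  · -- D·Z·T2 = D·X5 + D·Gc ≥ 0 by KEY′, then divide by D·Z > 0
    have hprod : 0 ≤ (prob p (PDEvent ends u a₂ c) * prob p (avoidAll ends a₂ {u})) *
        T2 p ends o a₂ c b u := by
      have e : (prob p (PDEvent ends u a₂ c) * prob p (avoidAll ends a₂ {u})) * T2 p ends o a₂ c b u =
          prob p (PDEvent ends u a₂ c) * X5 p ends o a₂ c b u +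
            prob p (PDEvent ends u a₂ c) * Gc p ends o u a₂ c b := by
        rw [mul_assoc, hZ]; ring
      rw [e, h]; linarith
    exact (mul_nonneg_iff_of_pos_left (mul_pos hD hZpos)).1 hprod
  · rw [T2_eq_zero_of_Z_eq_zero p ends o a₂ c b u hp hZzero.symm]

end Key

end RootLeafU

end Summit.Ventures.PercRepro2
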